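import Literature.NumberTheory.Automorphic.UnitaryGroupAutomorphicRep
import Mathlib.LinearAlgebra.Matrix.NonsingularInverse
import HarnessLib

/-!
# The Cayley transform of a skew-adjoint matrix preserves the form

Topic `NumberTheory/Automorphic`; namespace `Literature.NumberTheory.Automorphic.UnitaryGroup`.  KERNEL ONLY: theorems;
no definition, no record, no named fact, no `sorry`.

For a commutative ring `R`, a ring endomorphism `σ : R →+* R` and a form matrix `H ∈ M_n(R)` the tree's
`unitaryGroupOfForm σ H = {g ∈ GL_n(R) | (σ g)ᵀ H g = H}` (`UnitaryGroupAutomorphicRep.lean`, [Mok2014, §1 p. 5]).  A matrix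
`c` is SKEW-ADJOINT for `(σ, H)` when `(σ c)ᵀ H = −H c` (`h(c u, w) = −h(u, c w)` for `h(x, y) = (σ x)ᵀ H y`).  THEOREM
(**`cayley_transpose_mul_mul`**): if `c` is skew-adjoint and `det (c − 1)`, `det (c + 1)` are units, the CAYLEY TRANSFORM
`γ = (c − 1)⁻¹ (c + 1)` satisfies `(σ γ)ᵀ H γ = H` — so its unit in `GL_n(R)` lies in `unitaryGroupOfForm σ H`
(`cayley_mem_unitaryGroupOfForm`).  This is the classical rational parametrisation of (a Zariski-dense part of) the
unitary group by its Lie algebra [Weyl1939, Chap. II §10; PlatonovRapinchuk1994, §2.3 proof of rationality]: the two lines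
`(σ(c ± 1))ᵀ H = −H (c ∓ 1)`, and `c − 1`, `c + 1`, their inverses commute.  Inverse direction (recorded for the consumer):
`γ` satisfies `c (γ − 1) = γ + 1`, i.e. `c (γ v − v) = γ v + v` (`cayley_mul_sub_one`).

Written for the cell `hodgecm-mathlib` (fan B, rung B-IV, KEY `b4-howe-compact-irreducible`, node (P) of the doubling
proof of `MoeglinVignerasWaldspurger1987.mvw_IV4_rankOne_irreducibleOrZero`: the test elements `γ_c ∈ U(V)(F_v)`).

## References
* [Weyl1939] H. Weyl, *The Classical Groups* (1939), Chap. II §10 (Cayley's rational parametrisation).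
* [PlatonovRapinchuk1994] V. Platonov, A. Rapinchuk, *Algebraic Groups and Number Theory* (1994), §2.3.
* [Mok2014] C. P. Mok, Mem. AMS 235 (2015), §1 Notation p. 5 (the unitary group of a form).
-/

set_option autoImplicit false

open scoped Matrix

namespace Literature.NumberTheory.Automorphic.UnitaryGroup

variable {R : Type*} [CommRing R] {n : Type*} [Fintype n] [DecidableEq n] (σ : R →+* R) (H : Matrix n n R)

/-- skew-adjointness moves `c + 1` across the form: `(σ(c + 1))ᵀ H = −H (c − 1)`. [cite: Weyl1939, Chap. II §10] -/
theorem transpose_map_add_one_mul (c : Matrix n n R) (hc : (c.map σ)ᵀ * H = -(H * c)) :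
    ((c + 1).map σ)ᵀ * H = -(H * (c - 1)) := by
  rw [Matrix.map_add σ (map_add σ), Matrix.map_one σ (map_zero σ) (map_one σ), Matrix.transpose_add, Matrix.transpose_one, add_mul,
    one_mul, hc, mul_sub, mul_one, neg_sub, sub_eq_neg_add]

/-- skew-adjointness moves `c − 1` across the form: `(σ(c − 1))ᵀ H = −H (c + 1)`. [cite: Weyl1939, Chap. II §10] -/
theorem transpose_map_sub_one_mul (c : Matrix n n R) (hc : (c.map σ)ᵀ * H = -(H * c)) :
    ((c - 1).map σ)ᵀ * H = -(H * (c + 1)) := by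
  rw [Matrix.map_sub σ (map_sub σ), Matrix.map_one σ (map_zero σ) (map_one σ), Matrix.transpose_sub, Matrix.transpose_one, sub_mul,
    one_mul, hc, mul_add, mul_one, neg_add']

/-- the inverse of `c − 1` moves across as `(σ((c − 1)⁻¹))ᵀ H = −H (c + 1)⁻¹` (`det (c ± 1)` units).
[cite: Weyl1939, Chap. II §10] -/
theorem transpose_map_inv_sub_one_mul (c : Matrix n n R) (hc : (c.map σ)ᵀ * H = -(H * c))
    (hm : IsUnit (c - 1).det) (hp : IsUnit (c + 1).det) :
    (((c - 1)⁻¹).map σ)ᵀ * H = -(H * (c + 1)⁻¹) := by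
  have h1 : (((c - 1)⁻¹).map σ)ᵀ * H = (((c - 1)⁻¹).map σ)ᵀ * H * (c + 1) * (c + 1)⁻¹ := by
    rw [Matrix.mul_assoc ((((c - 1)⁻¹).map σ)ᵀ * H), Matrix.mul_nonsing_inv _ hp, Matrix.mul_one]
  rw [h1, Matrix.mul_assoc ((((c - 1)⁻¹).map σ)ᵀ), ← neg_neg (H * (c + 1)), ← transpose_map_sub_one_mul σ H c hc,
    Matrix.mul_neg, Matrix.neg_mul, ← Matrix.mul_assoc, ← Matrix.transpose_mul, ← Matrix.map_mul,
    Matrix.mul_nonsing_inv _ hm, Matrix.map_one σ (map_zero σ) (map_one σ), Matrix.transpose_one, Matrix.one_mul]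

/-- **the Cayley transform `γ = (c − 1)⁻¹ (c + 1)` of a skew-adjoint `c` preserves the form**: `(σ γ)ᵀ H γ = H`
(`det (c ± 1)` units). [cite: Weyl1939, Chap. II §10] -/
theorem cayley_transpose_mul_mul (c : Matrix n n R) (hc : (c.map σ)ᵀ * H = -(H * c))
    (hm : IsUnit (c - 1).det) (hp : IsUnit (c + 1).det) :
    (((c - 1)⁻¹ * (c + 1)).map σ)ᵀ * H * ((c - 1)⁻¹ * (c + 1)) = H := by
  -- `A = c - 1`, `B = c + 1` commute, hence so do `A`, `B⁻¹`
  have hAB : (c - 1) * (c + 1) = (c + 1) * (c - 1) := by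
    simp only [sub_mul, mul_add, add_mul, mul_sub, one_mul, mul_one]; abel
  have hcomm : (c - 1) * (c + 1)⁻¹ = (c + 1)⁻¹ * (c - 1) := by
    calc (c - 1) * (c + 1)⁻¹ = (c + 1)⁻¹ * ((c + 1) * (c - 1)) * (c + 1)⁻¹ := by
          rw [← Matrix.mul_assoc, Matrix.nonsing_inv_mul _ hp, Matrix.one_mul]
      _ = (c + 1)⁻¹ * (c - 1) := by
          rw [← hAB, Matrix.mul_assoc, Matrix.mul_assoc, Matrix.mul_nonsing_inv _ hp, Matrix.mul_one]
  have hX := transpose_map_inv_sub_one_mul σ H c hc hm hp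
  have hB := transpose_map_add_one_mul σ H c hc
  rw [Matrix.map_mul, Matrix.transpose_mul]
  have e1 : ((c + 1).map σ)ᵀ * (((c - 1)⁻¹).map σ)ᵀ * H * ((c - 1)⁻¹ * (c + 1)) =
      ((c + 1).map σ)ᵀ * ((((c - 1)⁻¹).map σ)ᵀ * H) * (c - 1)⁻¹ * (c + 1) := by
    simp only [Matrix.mul_assoc]
  rw [e1, hX]
  have e2 : ((c + 1).map σ)ᵀ * -(H * (c + 1)⁻¹) * (c - 1)⁻¹ * (c + 1) =
      -((((c + 1).map σ)ᵀ * H) * ((c + 1)⁻¹ * ((c - 1)⁻¹ * (c + 1)))) := by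
    simp only [Matrix.mul_neg, Matrix.neg_mul, Matrix.mul_assoc]
  rw [e2, hB, Matrix.neg_mul, neg_neg, Matrix.mul_assoc H, ← Matrix.mul_assoc (c - 1) (c + 1)⁻¹, hcomm,
    Matrix.mul_assoc (c + 1)⁻¹ (c - 1), ← Matrix.mul_assoc (c - 1) (c - 1)⁻¹, Matrix.mul_nonsing_inv _ hm,
    Matrix.one_mul, Matrix.nonsing_inv_mul _ hp, Matrix.mul_one]

/-- the defining relation of the Cayley transform, inverse-free: `c (γ − 1) = γ + 1` for `γ = (c − 1)⁻¹ (c + 1)`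
(`det (c − 1)` a unit). [cite: Weyl1939, Chap. II §10] -/
theorem cayley_mul_sub_one (c : Matrix n n R) (hm : IsUnit (c - 1).det) :
    c * ((c - 1)⁻¹ * (c + 1) - 1) = (c - 1)⁻¹ * (c + 1) + 1 := by
  -- `γ - 1 = (c-1)⁻¹ ((c+1) - (c-1))`, `γ + 1 = (c-1)⁻¹ ((c+1) + (c-1))`, and `c (c-1)⁻¹ = (c-1)⁻¹ c`
  have hcc : (c - 1) * c = c * (c - 1) := by rw [sub_mul, mul_sub, one_mul, mul_one]
  have hcomm : c * (c - 1)⁻¹ = (c - 1)⁻¹ * c := by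
    calc c * (c - 1)⁻¹ = (c - 1)⁻¹ * (c - 1) * c * (c - 1)⁻¹ := by rw [Matrix.nonsing_inv_mul _ hm, Matrix.one_mul]
      _ = (c - 1)⁻¹ * (c * (c - 1)) * (c - 1)⁻¹ := by rw [Matrix.mul_assoc (c - 1)⁻¹ (c - 1) c, hcc]
      _ = (c - 1)⁻¹ * c := by rw [Matrix.mul_assoc, Matrix.mul_assoc, Matrix.mul_nonsing_inv _ hm, Matrix.mul_one]
  have h1 : (c - 1)⁻¹ * ((c + 1) - (c - 1)) = (c - 1)⁻¹ * (c + 1) - 1 := by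
    rw [Matrix.mul_sub (c - 1)⁻¹ (c + 1) (c - 1), Matrix.nonsing_inv_mul _ hm]
  have h2 : (c - 1)⁻¹ * ((c + 1) + (c - 1)) = (c - 1)⁻¹ * (c + 1) + 1 := by
    rw [Matrix.mul_add (c - 1)⁻¹ (c + 1) (c - 1), Matrix.nonsing_inv_mul _ hm]
  rw [← h1, ← h2, ← Matrix.mul_assoc, hcomm, Matrix.mul_assoc]
  congr 1
  simp only [mul_sub, mul_add, mul_one]
  abel

/-- **membership form**: the unit of `GL_n(R)` defined by the Cayley transform lies in `unitaryGroupOfForm σ H`.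
[cite: Mok2014, §1 Notation p. 5] -/
theorem cayley_mem_unitaryGroupOfForm (c : Matrix n n R) (hc : (c.map σ)ᵀ * H = -(H * c))
    (hm : IsUnit (c - 1).det) (hp : IsUnit (c + 1).det)
    (hγ : IsUnit ((c - 1)⁻¹ * (c + 1) : Matrix n n R)) :
    (hγ.unit : GL n R) ∈ unitaryGroupOfForm σ H := by
  show (((hγ.unit : GL n R) : Matrix n n R).map σ)ᵀ * H * ((hγ.unit : GL n R) : Matrix n n R) = H
  rw [IsUnit.unit_spec]
  exact cayley_transpose_mul_mul σ H c hc hm hp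

/-- the Cayley transform is invertible (`det (c ± 1)` units). [cite: Weyl1939, Chap. II §10] -/
theorem isUnit_cayley (c : Matrix n n R) (hm : IsUnit (c - 1).det) (hp : IsUnit (c + 1).det) :
    IsUnit ((c - 1)⁻¹ * (c + 1) : Matrix n n R) := by
  rw [Matrix.isUnit_iff_isUnit_det, Matrix.det_mul]
  exact (Matrix.isUnit_nonsing_inv_det_iff.2 hm).mul hp

end Literature.NumberTheory.Automorphic.UnitaryGroup
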